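import Literature.Claims.NS.ClayR3BlowupAlternative
import Literature.Claims.NS.ClayR3LerayHopfBridge
import HarnessLib

/-!
# Claim C146 — Rollo Dicks, «Global Regularity of the Three-Dimensional Incompressible Navier-Stokes
# Equations via Exhaustion of Continuations» (Zenodo record 18963533, 2026-03-11)

Skeleton for the NS-claims map (cell `ns-claims`, D-0090; row C146, RULINGS v1.35 (4), lead-1 g5). Text of
record = TEXT A «…Unconditional_Forward_Proof.pdf» (sha256[:16] `d00f084e01e7564c`, 15 pp., PDF page =
printed page; census pin `census/texts/Dicks2026/`, lines = `pages/pNNN.txt`). TEXT B of the same record (3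
pp.) and the companion concept 18945886 are lineage (CARD §1). NUMBERED AS A CLAIMED BRIDGE (chair's call): the
only numbered main theorem, Thm 6.3 p.10 l.6–19, is printed CONDITIONAL on Definition 6.1 (uniqueness of
Leray–Hopf weak solutions from every `C_c^∞` divergence-free datum — «an open problem in full generality»,
Remark 6.2 p.9 l.63–65; §7 p.10 l.46–47), while the abstract p.1 l.6–27 states the conclusion
unconditionally; the drift is a CARD §3 / Clay-link delta, never the locator.

Typing (nothing of the paper is asserted; every printed step is a `def … : Prop`; the composition
`claim_of_steps` and the Clay-link lemmas are proved):
* `ClaimedTheorem` = Thm 6.3 AS PRINTED: `∀ ν > 0, WellPosed61 ν → ∀ u₀ ∈ C_c^∞ div-free, the Cauchy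
  problem (ν, f ≡ 0, u₀) has a global smooth solution in the paper's own sense §1.1 (1)–(3) p.3 l.18–23`
  (rendered `clayR3.Solvable ν 0 u₀`: smooth `u, p` on `ℝ³ × [0,∞)`, (1)–(3), bounded energy — the
  paper's (3)). `WellPosed61 ν` = Def 6.1 with Def 2.1 = the tree's `IsGlobalLerayHopf` (uniqueness in
  the a.e. sense at every `t > 0`, so that the hypothesis is the genuine open statement and not a
  null-set artefact).
* The printed proof of Thm 6.3 (p.10 l.20–44; = §9 chain p.13 l.45–51): «Assume … T* < ∞. Then E(T*−) =
  ∞» (§3.1 (14), `Step30_Setup`) → Step 1 `Prop31` (Topological Exhaustion, p.6 l.19–36; functions face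
  over an extended-real enstrophy profile, the grain of its sentence l.35–36, + the solution-grain
  instantiation `Prop31_sol`), `Lemma32` (proved: `lemma32_holds`), `Lemma33` → Step 2 `Lemma41_18`
  ((18) p.7 l.47–49, the one mathematical display of §4; «ill-posed» / «deterministic selection
  mechanism» (Lemma 4.1, Cor 4.3) have no printed definition and are recorded in the docstrings, not
  typed) → Step 3 `Step52A` / `Step52B_22` / `Step52B_23` (Thm 5.2 p.8 l.59 – p.9 l.50) → Step 4 closure.
  THE KERNEL COMPOSITION CONSUMES STEP 3 ONLY (with the tree's blow-up alternative for the tacit «Let u be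
  the unique local smooth solution … assume T* < ∞» and the hypothesis `WellPosed61`): as printed, Thm
  5.2 is stated «under the assumption of blowup at T*» alone, so Steps 1–2 are logically idle in the
  author's own proof; they are typed and recorded (print order p.10 l.24–32 puts them first).
* Galerkin approximations (§2.5 (13), §5): the printed scheme projects «onto the first n eigenfunctions of
  the Stokes operator A = −P_Leray Δ» on `ℝ³` (p.5 l.74–79), an operator with no eigenfunctions in `L²(ℝ³)`;
  the skeleton therefore quantifies Thm 5.2 over an ARBITRARY family `ωs : ℕ → ℝ³ → ℝ³` of smooth fields
  («ω_n … smooth for all time, including at T*», p.8 l.37–40) standing for «the Galerkin vorticities at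
  T*» — STRONGER than printed in `Step52A`/`Step52B_23` (recorded; a kill at the functions grain that
  uses a non-Galerkin feature of `ωs` is F3-exposed), and exactly as argued in `Step52B_22` (whose printed
  proof l.30–37 uses only the compactness of `S²` and pointwise values).

## References
* R. Dicks, Zenodo record 18963533 (2026), TEXT A. [Dicks2026]
* C. L. Fefferman, CMI 2006, (A) with (4)–(7) p. 2. [FeffermanClay2006]
* J. Leray, Acta Math. 63 (1934), §III. [Leray1934]

WHAT THIS IS NOT: not a claim about NS regularity or blow-up; not a claim about any author beyond the
typed locator.
-/

noncomputable section

open Set Function Filter MeasureTheory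
open scoped Topology ENNReal NNReal ContDiff

namespace Literature.Claims.NS.Dicks2026

open Literature.Analysis Literature.Analysis.FluidPDE Literature.Claims.NS.ClayVariants

/-! ### Vocabulary (definitions with bodies; nothing asserted) -/

/-- `ℝ³` (plumbing). [folklore] -/
abbrev E3 : Type := EuclideanSpace ℝ (Fin 3)

/-- (2) p.3 l.8–17: «smooth, divergence-free initial data u₀ ∈ C_c^∞(ℝ³; ℝ³), ∇·u₀ = 0» (also the data
class of Def 6.1 and Thm 6.3). [cite: Dicks2026, (2) p.3 l.8–17] -/
def IsSmoothDatum (u₀ : E3 → E3) : Prop :=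
  ContDiff ℝ ∞ u₀ ∧ HasCompactSupport u₀ ∧ NSWave0.IsDivFree u₀

/-- **Definition 6.1 (p.9 l.55–62) «deterministically well-posed from smooth initial data»**: for every
`u₀ ∈ C_c^∞` with `∇·u₀ = 0` there exists a unique Leray–Hopf weak solution in the sense of Def 2.1
(p.5 l.46–72: `u ∈ L^∞(0,∞;L²) ∩ L²(0,∞;H¹)`, weak formulation with divergence-free tests, energy
inequality a.e., strong attainment of the datum = the tree's `IsGlobalLerayHopf ν 0 u₀`), at viscosity
`ν`, no force. Uniqueness is rendered «any two agree a.e. at every t > 0» (weak solutions are classes of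
functions). The paper itself calls this open (Remark 6.2 p.9 l.63–65).
[cite: Dicks2026, Def 6.1 p.9 l.55–62; Def 2.1 p.5 l.46–72] -/
def WellPosed61 (ν : ℝ) : Prop :=
  ∀ u₀ : E3 → E3, IsSmoothDatum u₀ →
    (∃ v : ℝ → E3 → E3, IsGlobalLerayHopf ν 0 u₀ v) ∧
      ∀ v₁ v₂ : ℝ → E3 → E3, IsGlobalLerayHopf ν 0 u₀ v₁ → IsGlobalLerayHopf ν 0 u₀ v₂ →
        ∀ t : ℝ, 0 < t → v₁ t =ᵐ[volume] v₂ t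

/-- «two distinct Leray-Hopf weak solutions with the same smooth initial data u₀» ((23), p.9 l.49–50):
the negation of the uniqueness clause of Def 6.1 for the datum `u₀`. [cite: Dicks2026, (23) p.9 l.44–50] -/
def NonUnique (ν : ℝ) (u₀ : E3 → E3) : Prop :=
  ∃ v₁ v₂ : ℝ → E3 → E3, IsGlobalLerayHopf ν 0 u₀ v₁ ∧ IsGlobalLerayHopf ν 0 u₀ v₂ ∧
    ¬ ∀ t : ℝ, 0 < t → v₁ t =ᵐ[volume] v₂ t

/-- **«the maximal time of smooth existence is T* < ∞»** (p.10 l.20–21; §3.1 p.6 l.3–5 «a smooth solution u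
of (1)–(2) develops a singularity at a first finite time T* < ∞») for «the unique local smooth solution»
(p.10 l.15) of the finite-energy problem §1.1: rendered by the right-hand alternative of the tree's blow-up
dichotomy for Clay data (`clayR3_solvable_or_supBlowup`): a finite-energy classical solution of the
unforced system on `[0,T*) × ℝ³` from `u₀`, `0 < T* < ∞`, with unbounded velocity, and no finite-energy
classical solution from `u₀` on any closed slab `[0,T]`, `T ≥ T*`.
[cite: Dicks2026, §3.1 p.6 l.3–5; Proof of Thm 6.3 p.10 l.20–21] -/
def IsBlowupScenario (ν : ℝ) (u₀ : E3 → E3) (Ts : ℝ) (u : ℝ → E3 → E3) (p : ℝ → E3 → ℝ) : Prop :=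
  0 < Ts ∧ IsClassicalNSSolutionOn (Ico 0 Ts) ν 0 u p ∧ u 0 = u₀ ∧
    (∃ A : ℝ≥0∞, A < ⊤ ∧ ∀ t ∈ Ico 0 Ts, ∫⁻ x, ‖u t x‖ₑ ^ 2 ≤ A) ∧
    (∀ M : ℝ, ∃ t ∈ Ico 0 Ts, ∃ x, M < ‖u t x‖) ∧
    ∀ T : ℝ, Ts ≤ T → ∀ (w : ℝ → E3 → E3) (q : ℝ → E3 → ℝ),
      IsClassicalNSSolutionOn (Icc 0 T) ν 0 w q → w 0 = u₀ →
        ¬ ∃ A : ℝ≥0∞, A < ⊤ ∧ ∀ t ∈ Icc 0 T, ∫⁻ x, ‖w t x‖ₑ ^ 2 ≤ A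

/-- The enstrophy profile `t ↦ E(t) = ½‖∇×v(·,t)‖²_{L²}` ((8) p.5 l.1–13; «Ẽ(t) … wherever ũ(·,t) ∈ H¹»,
p.6 l.13–18), as an EXTENDED-real number (`+∞` when the integral diverges; the print leaves `Ẽ` undefined
off `H¹` and never defines «Ẽ(T*+)» — recorded; the classical `curl` carries the tree's junk value where a
slice is not differentiable). [cite: Dicks2026, (8) p.5 l.1–13; §3.1 p.6 l.13–18] -/
def eprofile (v : ℝ → E3 → E3) (t : ℝ) : EReal :=
  (((2 : ℝ≥0∞)⁻¹ * ∫⁻ x, ‖curl (v t) x‖ₑ ^ 2 : ℝ≥0∞) : EReal)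

/-- The profile used by Prop 3.1: the strong solution's enstrophy before `T*`, the continuation's after
(«E(T*−) = ∞ while Ẽ(T*+) < ∞», p.6 l.31–34). [cite: Dicks2026, Prop 3.1 p.6 l.31–34] -/
def spliced (E₁ E₂ : ℝ → EReal) (Ts : ℝ) (t : ℝ) : EReal :=
  if t < Ts then E₁ t else E₂ t

/-- «E(T*−) = ∞» (p.6 l.20–21; l.10–11 «E(t) → ∞ as t → T*−»). [cite: Dicks2026, §3.1 p.6 l.10–11] -/
def BlowsUpLeft (E : ℝ → EReal) (Ts : ℝ) : Prop :=
  Tendsto E (𝓝[<] Ts) (𝓝 ⊤)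

/-- **Case 1 «Parse through infinity»** (p.6 l.25–26): «the enstrophy transitions through +∞ and assumes
negative values for t > T*». [cite: Dicks2026, Prop 3.1 Case 1 p.6 l.25–26] -/
def Case1 (E : ℝ → EReal) (Ts : ℝ) : Prop :=
  ∃ t : ℝ, Ts < t ∧ E t < 0

/-- **Case 2 «Persistence at infinity»** (p.6 l.27–30): «Ẽ(t) = ∞ for t ∈ [T*, T* + ε] for some ε > 0».
[cite: Dicks2026, Prop 3.1 Case 2 p.6 l.27–30] -/
def Case2 (E : ℝ → EReal) (Ts : ℝ) : Prop :=
  ∃ ε : ℝ, 0 < ε ∧ ∀ t ∈ Icc Ts (Ts + ε), E t = ⊤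

/-- **Case 3 «Reflection from infinity»** (p.6 l.31–34): «The enstrophy drops discontinuously: Ẽ(T*+) < ∞»
— `Ẽ(T*+)` read as the right limit at `T*` (standard notation; p.7 l.6–8 «E(T*−) = ∞ and Ẽ(T*+) <
∞»): the right limit exists and is finite. [cite: Dicks2026, Prop 3.1 Case 3 p.6 l.31–34] -/
def Case3 (E : ℝ → EReal) (Ts : ℝ) : Prop :=
  ∃ L : ℝ, Tendsto E (𝓝[>] Ts) (𝓝 (L : EReal))

/-- Case 3, WEAKEST reading of l.36 «returns to finite values immediately»: finite values occur
arbitrarily soon after `T*`. Offered so that a kernel reading of Prop 3.1 does not hinge on the typist's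
choice (`case3w_of_case3`). [cite: Dicks2026, Prop 3.1 p.6 l.35–36] -/
def Case3w (E : ℝ → EReal) (Ts : ℝ) : Prop :=
  ∃ᶠ t in 𝓝[>] Ts, E t < ⊤

/-! ### The claimed statement -/

/-- **Theorem 6.3 (p.10 l.6–19), AS PRINTED — a conditional statement («Suppose that the Navier-Stokes
equations are deterministically well-posed from smooth initial data in the sense of Definition 6.1. Then u
extends to a global smooth solution: u ∈ C^∞(ℝ³ × [0,∞)) (24)»)**, for every `ν > 0` (p.3 l.8), the
conclusion rendered in the paper's own statement of the problem §1.1 p.3 l.18–23 ((1)–(3): global smooth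
solution with `sup_t ‖u‖_{L²} < ∞`) = `clayR3.Solvable ν 0 u₀`. The ABSTRACT p.1 l.6–27 drops the
hypothesis (CARD §3 delta). [cite: Dicks2026, Thm 6.3 p.10 l.6–19] [claim: Dicks2026, status: disputed] -/
def ClaimedTheorem : Prop :=
  ∀ ν : ℝ, 0 < ν → WellPosed61 ν → ∀ u₀ : E3 → E3, IsSmoothDatum u₀ → clayR3.Solvable ν 0 u₀

/-- The `C_c^∞`-data sub-statement of Clay (A) at viscosity `ν` (the conclusion of Thm 6.3 freed of its
hypothesis). [cite: FeffermanClay2006, (A) with (4) (6) (7) p. 2] -/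
def RegularityAtCc (ν : ℝ) : Prop :=
  ∀ u₀ : E3 → E3, IsSmoothDatum u₀ → clayR3.Solvable ν 0 u₀

/-! ### The paper's steps (no assertion) -/

/-- **§3.1 p.6 l.3–11, (14) — setup**: at a first singular time `T*` of the smooth solution, «lim_{t→T*−}
‖ω(·,t)‖_{L∞} = ∞ (14), and consequently E(t) → ∞ as t → T*−» (attributed to Beale–Kato–Majda (5)).
Solution grain. [claim: Dicks2026, status: disputed] -/
def Step30_Setup (ν : ℝ) : Prop :=
  ∀ (u₀ : E3 → E3) (Ts : ℝ) (u : ℝ → E3 → E3) (p : ℝ → E3 → ℝ), IsBlowupScenario ν u₀ Ts u p →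
    Tendsto (fun t => ⨆ x, ‖curl (u t) x‖ₑ) (𝓝[<] Ts) (𝓝 ⊤) ∧ BlowsUpLeft (eprofile u) Ts

/-- **§3.1 p.6 l.12–13 — «Let ũ be a Leray-Hopf weak continuation of u for t > T*, which exists by Leray's
theorem»**: a global Leray–Hopf weak solution from `u₀` exists (Leray 1934; tree
`exists_isGlobalLerayHopf_of_clayDatum`) — proved below (`step30b_holds`).
[cite: Dicks2026, §3.1 p.6 l.12–13] [cite: Leray1934, §III Thm. of §34] -/
def Step30b_Continuation (ν : ℝ) : Prop :=
  ∀ u₀ : E3 → E3, IsSmoothDatum u₀ → ∃ v : ℝ → E3 → E3, IsGlobalLerayHopf ν 0 u₀ v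

/-- **PROPOSITION 3.1 «Topological Exhaustion» (p.6 l.19–36), at the grain of its sentence l.35–36 «This is
an exhaustive list: the enstrophy either changes sign (Case 1), remains infinite for positive duration
(Case 2), or returns to finite values immediately (Case 3)»** — for an extended-real profile `E` of time
with `E(T*−) = ∞`: Case 1 ∨ Case 2 ∨ Case 3 (Case 3 = «Ẽ(T*+) < ∞», the finite right limit). Functions
face. («exactly one»: the exclusivity clause is not typed.) [claim: Dicks2026, status: disputed] -/
def Prop31 : Prop :=
  ∀ (E : ℝ → EReal) (Ts : ℝ), BlowsUpLeft E Ts → Case1 E Ts ∨ Case2 E Ts ∨ Case3 E Ts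

/-- Prop 3.1 with the WEAKEST reading of Case 3 (`Case3w`); implied by `Prop31` (`prop31w_of_prop31`).
[claim: Dicks2026, status: disputed] -/
def Prop31w : Prop :=
  ∀ (E : ℝ → EReal) (Ts : ℝ), BlowsUpLeft E Ts → Case1 E Ts ∨ Case2 E Ts ∨ Case3w E Ts

/-- **Prop 3.1 at the solution grain** («the behavior of the enstrophy at and immediately after T*»): for
the strong solution of a blow-up scenario and any Leray–Hopf continuation `ũ` from `u₀`, the spliced
profile (E before `T*`, Ẽ from `T*` on) falls into Case 1 ∨ Case 2 ∨ Case 3. Instance of `Prop31`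
(`prop31_sol_of_prop31`). [claim: Dicks2026, status: disputed] -/
def Prop31_sol (ν : ℝ) : Prop :=
  ∀ (u₀ : E3 → E3) (Ts : ℝ) (u : ℝ → E3 → E3) (p : ℝ → E3 → ℝ), IsBlowupScenario ν u₀ Ts u p →
    ∀ v : ℝ → E3 → E3, IsGlobalLerayHopf ν 0 u₀ v → BlowsUpLeft (eprofile u) Ts →
      Case1 (spliced (eprofile u) (eprofile v) Ts) Ts ∨ Case2 (spliced (eprofile u) (eprofile v) Ts) Ts ∨
        Case3 (spliced (eprofile u) (eprofile v) Ts) Ts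

/-- **LEMMA 3.2 (p.6 l.38–48) «Case 1 is algebraically impossible»** — an enstrophy profile is a squared
norm, `≥ 0`. TRUE; proved for every (spliced) enstrophy profile (`Lemma32_holds`).
[cite: Dicks2026, Lemma 3.2 p.6 l.38–48] -/
def Lemma32 : Prop :=
  ∀ (u v : ℝ → E3 → E3) (Ts : ℝ), ¬ Case1 (spliced (eprofile u) (eprofile v) Ts) Ts

/-- **LEMMA 3.3 (p.6 l.50 – p.7 l.4) «Case 2 is forbidden by the Leray energy inequality»**, at the grain
printed in (15)–(16): a `[0,∞]`-valued profile with `2ν ∫₀ᵀ 2E(s) ds ≤ ‖u₀‖²` (finite) for every `T` is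
not `+∞` on an interval of positive length after `T*`. Functions face (the passage from the Leray–Hopf
dissipation bound to «Ẽ» is the print's «‖∇u‖² ≥ ‖ω‖² = 2E», l.61–71); TRUE, proved below
(`Lemma33_holds`). [cite: Dicks2026, Lemma 3.3 p.6 l.50 – p.7 l.4] -/
def Lemma33 : Prop :=
  ∀ (E : ℝ → ℝ≥0∞) (Ts C ν : ℝ), 0 ≤ Ts → 0 < ν →
    (∀ T : ℝ, 0 < T → 2 * ν * (∫⁻ s in Ioo 0 T, 2 * E s).toReal ≤ C ∧ (∫⁻ s in Ioo 0 T, 2 * E s) < ⊤) →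
      ¬ Case2 (fun t => (E t : EReal)) Ts

/-- **§4, LEMMA 4.1 «Adjoint Collapse at T*» (p.7 l.21–61) — its one mathematical display (18) «‖∇u(·,t)‖_{L^{3/2}}
→ ∞ as t → T*−»** along the strong solution of a blow-up scenario (from ESS + «the Calderón–Zygmund
estimate ‖∇u‖_{L^{3/2}} ≤ C‖ω‖_{L^{3/2}}», l.32–49). The lemma's conclusion «(17) is ill-posed at T*» and Cor
4.3 «cannot serve as a deterministic selection mechanism» (p.8 l.1–17) carry no printed definition and are
not typed (recorded). Solution grain. [claim: Dicks2026, status: disputed] -/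
def Lemma41_18 (ν : ℝ) : Prop :=
  ∀ (u₀ : E3 → E3) (Ts : ℝ) (u : ℝ → E3 → E3) (p : ℝ → E3 → ℝ), IsBlowupScenario ν u₀ Ts u p →
    Tendsto (fun t => ∫⁻ x, ‖fderiv ℝ (u t) x‖ₑ ^ (3 / 2 : ℝ)) (𝓝[<] Ts) (𝓝 ⊤)

/-- The unit direction field `ω̂ = ω/|ω|` ((10) p.5 l.29–35; «defined where |ω_n| > 0», the tree's junk `0`
elsewhere). [cite: Dicks2026, (10) p.5 l.29–35] -/
def dir (w : E3 → E3) (x : E3) : E3 := ‖w x‖⁻¹ • w x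

/-- **Definition 5.1 «Directional Convergence» (p.8 l.47–58)** for a family `ωs` of (Galerkin) vorticity
fields at time `T*`: «there exists ξ̂ ∈ L^∞(B_ρ(x₀); S²) for some ρ > 0 and some x₀ ∈ ℝ³ such that ω̂_n(·,T*)
→ ξ̂ strongly in L²(B_ρ(x₀)) (20) and ξ̂ is Lipschitz continuous on B_ρ(x₀)».
[cite: Dicks2026, Def 5.1 p.8 l.47–58] -/
def Converges51 (ωs : ℕ → E3 → E3) : Prop :=
  ∃ (x₀ : E3) (ρ : ℝ), 0 < ρ ∧ ∃ ξ : E3 → E3, (∀ x ∈ Metric.ball x₀ ρ, ‖ξ x‖ = 1) ∧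
    (∃ K : ℝ≥0, LipschitzOnWith K ξ (Metric.ball x₀ ρ)) ∧
    Tendsto (fun n => ∫⁻ x in Metric.ball x₀ ρ, ‖dir (ωs n) x - ξ x‖ₑ ^ 2) atTop (𝓝 0)

/-- **(22) p.9 l.33–37**: «there exist at least two subsequences converging to distinct limits: ω̂_{n_k}(·,T*)
→ ξ̂₁, ω̂_{n_ℓ}(·,T*) → ξ̂₂, ξ̂₁ ≠ ξ̂₂» — read with l.33 «the direction fields ω̂_n(x₀,T*) (evaluated at any
accumulation point of the vorticity maximum)»: two subsequences whose direction values at some point `x₀`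
converge to distinct limits. [cite: Dicks2026, (22) p.9 l.33–37] -/
def TwoLimits22 (ωs : ℕ → E3 → E3) : Prop :=
  ∃ (x₀ : E3) (φ ψ : ℕ → ℕ), StrictMono φ ∧ StrictMono ψ ∧ ∃ ξ₁ ξ₂ : E3, ξ₁ ≠ ξ₂ ∧
    Tendsto (fun k => dir (ωs (φ k)) x₀) atTop (𝓝 ξ₁) ∧ Tendsto (fun k => dir (ωs (ψ k)) x₀) atTop (𝓝 ξ₂)

/-- A family of smooth fields («Because each u_n is smooth, the vorticity ω_n … [is] smooth for all time,
including at T*», p.8 l.37–40) — the skeleton's stand-in for «the Galerkin vorticities ω_n(·,T*)» (§2.5 (13)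
p.5 l.74–83 projects onto «the first n eigenfunctions of the Stokes operator» on `ℝ³`; see the module
docstring). [cite: Dicks2026, §5.1 p.8 l.24–40] -/
def IsSmoothFamily (ωs : ℕ → E3 → E3) : Prop :=
  ∀ n : ℕ, ContDiff ℝ ∞ (ωs n)

/-- **THEOREM 5.2 (A) (p.8 l.63–66; proof p.9 l.6–29)**: «The direction fields converge in the sense of
Definition 5.1. Then … by Constantin's geometric regularity criterion [4], the solution is regular at T*»,
«Therefore T* is a regular point, contradicting the assumption of blowup» — along a blow-up scenario, for
the (Galerkin) family at `T*`: convergence ⇒ absurd. Solution grain; family abstracted (module docstring).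
[claim: Dicks2026, status: disputed] -/
def Step52A (ν : ℝ) : Prop :=
  ∀ (u₀ : E3 → E3) (Ts : ℝ) (u : ℝ → E3 → E3) (p : ℝ → E3 → ℝ), IsBlowupScenario ν u₀ Ts u p →
    ∀ ωs : ℕ → E3 → E3, IsSmoothFamily ωs → Converges51 ωs → False

/-- **THEOREM 5.2 (B), first inference (p.9 l.1–2 with l.30–37)**: «The direction fields do not converge to a
unique regular limit. Then different subsequences {n_k} and {n_ℓ} produce … distinct … direction fields» —
«Since S² is compact, the direction fields ω̂_n(x₀,T*) … have convergent subsequences. If the full sequence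
does not converge, there exist at least two subsequences converging to distinct limits (22)». Typed at the
grain argued (a smooth family; compactness of `S²`, pointwise values): ¬(A) ⇒ (22).
[claim: Dicks2026, status: disputed] -/
def Step52B_22 : Prop :=
  ∀ ωs : ℕ → E3 → E3, IsSmoothFamily ωs → ¬ Converges51 ωs → TwoLimits22 ωs

/-- **THEOREM 5.2 (B), second inference (p.9 l.38–50), (22) ⇒ (23)**: «The Galerkin solutions along these
subsequences converge to (possibly different) Leray-Hopf weak solutions ũ⁽¹⁾ and ũ⁽²⁾ … for t > T*, the
distinct vorticity directions propagate forward through the vortex stretching term (11), producing distinct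
velocity fields (23). This yields two distinct Leray-Hopf weak solutions with the same smooth initial data
u₀». Solution grain; family abstracted. [claim: Dicks2026, status: disputed] -/
def Step52B_23 (ν : ℝ) : Prop :=
  ∀ (u₀ : E3 → E3) (Ts : ℝ) (u : ℝ → E3 → E3) (p : ℝ → E3 → ℝ), IsBlowupScenario ν u₀ Ts u p →
    ∀ ωs : ℕ → E3 → E3, IsSmoothFamily ωs → TwoLimits22 ωs → NonUnique ν u₀

/-! ### Plumbing about the tree's objects (proved; no printed step is asserted) -/

/-- A `C_c^∞` divergence-free datum is a Clay datum: smooth, divergence free, of class (4).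
[cite: FeffermanClay2006, (4) p. 1] -/
theorem IsSmoothDatum.rapidDecay {u₀ : E3 → E3} (h : IsSmoothDatum u₀) : HasRapidSpatialDecay u₀ :=
  HasRapidSpatialDecay.of_hasCompactSupport h.1 h.2.1

/-- `Case3 ⇒ Case3w`: a finite right limit gives finite values arbitrarily soon after `T*` (the two
readings of Prop 3.1 Case 3, p.6 l.31–36). [cite: Dicks2026, Prop 3.1 p.6 l.31–36] -/
theorem case3w_of_case3 {E : ℝ → EReal} {Ts : ℝ} (h : Case3 E Ts) : Case3w E Ts := by
  obtain ⟨L, hL⟩ := h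
  have hev : ∀ᶠ t in 𝓝[>] Ts, E t < ⊤ :=
    hL.eventually (eventually_lt_nhds (EReal.coe_lt_top L))
  exact hev.frequently

/-- `Prop31 ⇒ Prop31w` (Prop 3.1 under the two readings of Case 3, p.6 l.19–36).
[cite: Dicks2026, Prop 3.1 p.6 l.19–36] -/
theorem prop31w_of_prop31 (h : Prop31) : Prop31w := fun E Ts hE =>
  (h E Ts hE).imp_right (Or.imp_right case3w_of_case3)

/-- The spliced profile agrees with the first profile to the left of `T*`. [folklore] -/
private theorem spliced_eventuallyEq_left (E₁ E₂ : ℝ → EReal) (Ts : ℝ) :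
    spliced E₁ E₂ Ts =ᶠ[𝓝[<] Ts] E₁ :=
  eventually_nhdsWithin_of_forall fun t (ht : t < Ts) => by simp [spliced, ht]

/-- `Prop31 ⇒ Prop31_sol`: the solution-grain Prop 3.1 (p.6 l.19–36) is the functions face instantiated at
the spliced enstrophy profile. [cite: Dicks2026, Prop 3.1 p.6 l.19–36] -/
theorem prop31_sol_of_prop31 (h : Prop31) (ν : ℝ) : Prop31_sol ν := by
  intro u₀ Ts u p _ v _ hleft
  refine h _ Ts ?_
  exact (tendsto_congr' (spliced_eventuallyEq_left (eprofile u) (eprofile v) Ts)).2 hleft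

/-- **`Lemma32` HOLDS**: enstrophy profiles are nonnegative extended reals, so Case 1 never occurs. A TRUE
printed step, recorded. [cite: Dicks2026, Lemma 3.2 p.6 l.38–48] -/
theorem Lemma32_holds : Lemma32 := by
  rintro u v Ts ⟨t, -, ht⟩
  have h0 : (0 : EReal) ≤ spliced (eprofile u) (eprofile v) Ts t := by
    unfold spliced eprofile
    split_ifs <;> exact EReal.coe_ennreal_nonneg _
  exact absurd ht (not_lt.2 h0)

/-- **`Lemma33` HOLDS** at the grain printed in (15)–(16): a profile that is `+∞` on `[T*, T*+ε]` has an
infinite time integral over `(0, T*+ε+1)`, contradicting the finite dissipation bound. A TRUE printed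
step (real-variable content), recorded. [cite: Dicks2026, Lemma 3.3 p.6 l.50 – p.7 l.4] -/
theorem Lemma33_holds : Lemma33 := by
  rintro E Ts C ν hTs - hint ⟨ε, hε, htop⟩
  have hT : 0 < Ts + ε + 1 := by linarith
  have hfin := (hint (Ts + ε + 1) hT).2
  have hsub : Ioo Ts (Ts + ε) ⊆ Ioo 0 (Ts + ε + 1) := fun t ht => ⟨by linarith [ht.1], by linarith [ht.2]⟩
  have htop' : ∀ t ∈ Ioo Ts (Ts + ε), 2 * E t = ⊤ := fun t ht => by
    have h := htop t ⟨ht.1.le, ht.2.le⟩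
    rw [EReal.coe_ennreal_eq_top_iff] at h
    rw [h, ENNReal.mul_top two_ne_zero]
  have hle : (∫⁻ s in Ioo Ts (Ts + ε), (⊤ : ℝ≥0∞)) ≤ ∫⁻ s in Ioo 0 (Ts + ε + 1), 2 * E s :=
    calc (∫⁻ s in Ioo Ts (Ts + ε), (⊤ : ℝ≥0∞)) = ∫⁻ s in Ioo Ts (Ts + ε), 2 * E s :=
          setLIntegral_congr_fun measurableSet_Ioo fun t ht => (htop' t ht).symm
      _ ≤ ∫⁻ s in Ioo 0 (Ts + ε + 1), 2 * E s := lintegral_mono_set hsub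
  have hvol : (∫⁻ s in Ioo Ts (Ts + ε), (⊤ : ℝ≥0∞)) = ⊤ := by
    rw [setLIntegral_const, Real.volume_Ioo, ENNReal.top_mul]
    simp [hε]
  rw [hvol, top_le_iff] at hle
  exact absurd hle hfin.ne

/-- **`Step30b_Continuation` HOLDS** (Leray 1934 via the tree's `exists_isGlobalLerayHopf_of_clayDatum`). A
TRUE printed step, recorded. [cite: Dicks2026, §3.1 p.6 l.12–13] [cite: Leray1934, §III Thm. of §34] -/
theorem step30b_holds {ν : ℝ} (hν : 0 < ν) : Step30b_Continuation ν := fun _ h =>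
  exists_isGlobalLerayHopf_of_clayDatum hν h.1 h.2.2 h.rapidDecay

/-! ### Composition (the paper's own implications, in the kernel) -/

/-- **COMPOSITION — PROVED.** For every `ν > 0`, under the hypothesis Def 6.1: a `C_c^∞` divergence-free
datum is a Clay datum, so (tree blow-up alternative, = «Let u be the unique local smooth solution … Assume
… T* < ∞», p.10 l.15–21) either the Cauchy problem is globally solvable or a blow-up scenario exists; in the
latter case Thm 5.2 applied to the (abstracted) Galerkin family at `T*`: (A) convergence is absurd
(`Step52A`), (B) non-convergence gives (22) (`Step52B_22`) and then two distinct Leray–Hopf solutions from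
`u₀` (`Step52B_23`), contradicting Def 6.1 — Steps 3–4 of the printed proof p.10 l.33–44. Steps 1–2
(`Prop31`, `Lemma32`, `Lemma33`, `Lemma41_18`) are typed above (3.2 and 3.3 proved) but not consumed: the printed Thm 5.2 is
stated under «blowup at T*» alone. [claim: Dicks2026, status: disputed] -/
theorem claim_of_steps (h52A : ∀ ν : ℝ, 0 < ν → Step52A ν) (h22 : Step52B_22)
    (h23 : ∀ ν : ℝ, 0 < ν → Step52B_23 ν) : ClaimedTheorem := by
  intro ν hν hW u₀ hu₀
  rcases clayR3_solvable_or_supBlowup hν hu₀.1 hu₀.2.2 hu₀.rapidDecay with hsol | hblow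
  · exact hsol
  exfalso
  obtain ⟨Ts, hTs, u, p, hcl, h0, hE, hunb, hno⟩ := hblow
  have hsc : IsBlowupScenario ν u₀ Ts u p := ⟨hTs, hcl, h0, hE, hunb, hno⟩
  -- the kernel needs one smooth family standing for the Galerkin vorticities at `T*`; the steps are
  -- typed for every such family, so any serves
  set ωs : ℕ → E3 → E3 := fun _ _ => 0 with hωs
  have hsm : IsSmoothFamily ωs := fun _ => contDiff_const
  by_cases hA : Converges51 ωs
  · exact h52A ν hν u₀ Ts u p hsc ωs hsm hA
  · obtain ⟨v₁, v₂, hv₁, hv₂, hne⟩ := h23 ν hν u₀ Ts u p hsc ωs hsm (h22 ωs hsm hA)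
    exact hne ((hW u₀ hu₀).2 v₁ v₂ hv₁ hv₂)

/-! ### The Clay link (proved, with the deltas explicit) -/

/-- `ClaimedTheorem` is, token for token, «Def 6.1 ⇒ the `C_c^∞`-data sub-statement of (A)» at every `ν > 0`.
[cite: Dicks2026, Thm 6.3 p.10 l.6–19; §7.1 (25) p.11] -/
theorem claimedTheorem_iff : ClaimedTheorem ↔ ∀ ν : ℝ, 0 < ν → WellPosed61 ν → RegularityAtCc ν :=
  Iff.rfl

/-- **Clay link, with the extra binder explicit**: IF Def 6.1 holds at every `ν > 0` (the paper's hypothesis,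
open by its own account), the claim delivers the `C_c^∞`-data sub-statement of (A) at every `ν > 0` — NOT
(A) itself, whose data class (4) is wider (Δ-data, CARD §3). [cite: FeffermanClay2006, (A) with (4) p. 2] -/
theorem clay_of_claimed_of_hyp (hW : ∀ ν : ℝ, 0 < ν → WellPosed61 ν) (h : ClaimedTheorem) :
    ∀ ν : ℝ, 0 < ν → RegularityAtCc ν :=
  fun ν hν => h ν hν (hW ν hν)

/-- Direction of the data delta: Clay (A) at `ν` implies the claim's conclusion at `ν` (every `C_c^∞` datum is
of class (4)); the converse is not claimed. [cite: FeffermanClay2006, (A) with (4) p. 2] -/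
theorem regularityAtCc_of_clayR3 {ν : ℝ} (h : clayR3.RegularityAt ν) : RegularityAtCc ν :=
  fun u₀ hu₀ => h u₀ hu₀.1 hu₀.2.2 hu₀.rapidDecay

end Literature.Claims.NS.Dicks2026

end
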